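import Literature.Barriers.NavierStokesRegularity.NavierStokesInequalityCantorCube
import Literature.Barriers.NavierStokesRegularity.NavierStokesInequalityGluingMeasure
import Literature.Analysis.FluidPDE.NormalisedPressureCompactSupport
import Literature.Analysis.FluidPDE.NormalisedPressureLpBoundProofs
import HarnessLib

/-!
# Scheffer's Cantor-set switching: `|p̃[𝔲]| |𝔲| ∈ L¹` (Scheffer 1987, Lemma 5.12, pressure part)

Barrier catalogue support file for `NavierStokesRegularity` (D-0021), a further layer of the
decomposition of `Literature.Barriers.NavierStokesRegularity.NavierStokesInequalityNearlyOneDimSingularSet`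
(Scheffer 1987 = Ożański 2020 Thm. 1.6). Companion of `NavierStokesInequalityCantorCube`
(`|𝔲|³ ∈ L¹`): here the pressure half of Scheffer's Lemma 5.12 — "`∫∫ |u||p| dx dt` is finite.
This follows from Lemma 5.11, Lemma 5.8 and (5.40) [the pressure formula
`p = Σ ∂ᵢ∂ⱼΨ ∗ (uᵢuⱼ)`] in a standard way" — for the glued field `𝔲 = Scheffer.glueSeq T τ w`
of a Cantor block and its pressure function `p̃[𝔲(t)]` (the tree's `normalisedPressure`, which
for the `C_c^∞` slices is (5.40)): by Hölder, `∫|p̃||u| ≤ ‖p̃‖_{3/2}‖u‖₃`, and by the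
Calderón–Zygmund bound `‖p̃[u]‖_{3/2} ≤ C‖|u|²‖_{3/2} = C‖u‖₃²` (Stein 1970, Ch. II §4.2, Thm. 3;
the tree's PROVED `stein1970_normalisedPressure_Lp_bound_holds`), so that
`∫|p̃[u]||u| ≤ C ∫|u|³` slice by slice, and `|𝔲|³ ∈ L¹` concludes. Also the joint
measurability of `(t,x) ↦ p̃[𝔲(t)](x)` on `(0,∞) × ℝ³` (continuous on each closed strip by the
accepted `continuousOn_normalisedPressure_slice`, glued by the accepted
`aestronglyMeasurable_glue`). Everything is PROVED.

## Contents

* `exists_lintegral_pressure_mul_enorm_le` — `∫ |p̃[u]| |u| ≤ C ∫ |u|³` for `u ∈ C_c^∞(ℝ³;ℝ³)`;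
* `IsNSICantorBlock.continuousOn_normalisedPressure_piece` — `(s,x) ↦ p̃[w j(s)](x)` is
  continuous on `[t_j,t_{j+1}] × ℝ³`;
* `IsNSICantorBlock.aestronglyMeasurable_normalisedPressure_glueSeq` — joint measurability of the
  pressure of the glued field on `(0,∞) × ℝ³`;
* `IsNSICantorBlock.lintegral_pressure_mul_enorm_lt_top` — **`∫∫_{(0,∞)×ℝ³} |p̃[𝔲]| |𝔲| < ∞`**.

## References

* V. Scheffer, Comm. Math. Phys. 110 (1987), Lemma 5.12 and (5.40). [`Scheffer1987`]
* W. S. Ożański, arXiv:1709.00602 (2017), §2 p. 6. [`Ozanski2017NSISingular`]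
* E. M. Stein, *Singular integrals and differentiability properties of functions* (1970),
  Ch. II §4.2, Thm. 3. [`Stein1971`]
-/

noncomputable section

open MeasureTheory Set Function Filter Topology TopologicalSpace Metric
open Literature.MeasureTheory.Hausdorff Literature.Analysis.FluidPDE
open scoped ENNReal NNReal InnerProductSpace RealInnerProductSpace ContDiff

namespace Literature.Barriers.NavierStokesRegularity

open Scheffer

/-! ### The slice bound `∫ |p̃[u]| |u| ≤ C ∫ |u|³` -/

/-- `‖ |u|² ‖ₑ = ‖u‖ₑ²` for the real-valued squared norm. [folklore] -/
theorem enorm_norm_sq (v : (EuclideanSpace ℝ (Fin 3))) : ‖(‖v‖ ^ 2 : ℝ)‖ₑ = ‖v‖ₑ ^ 2 := by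
  rw [Real.enorm_eq_ofReal (sq_nonneg _), ENNReal.ofReal_pow (norm_nonneg _), ofReal_norm]

/-- **`∫ |p̃[u]| |u| ≤ C ∫ |u|³` for `u ∈ C_c^∞(ℝ³; ℝ³)`**, with the Calderón–Zygmund constant `C`
of the tree's (proved) Stein bound for `p = 3/2`: Hölder `∫|p̃||u| ≤ ‖p̃‖_{3/2}‖u‖₃` and
`‖p̃[u]‖_{3/2} ≤ C ‖|u|²‖_{3/2} = C ‖u‖₃²` (Scheffer 1987, Lemma 5.12 "in a standard way";
Stein 1970, Ch. II §4.2 Thm. 3). [cite: Scheffer1987, Lemma 5.12] [cite: Stein1971, Ch. II §4.2 Thm 3] -/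
theorem exists_lintegral_pressure_mul_enorm_le :
    ∃ C : ℝ≥0, ∀ u : (EuclideanSpace ℝ (Fin 3)) → (EuclideanSpace ℝ (Fin 3)), ContDiff ℝ ∞ u → HasCompactSupport u →
      ∫⁻ x, ‖normalisedPressure u x‖ₑ * ‖u x‖ₑ ≤ C * ∫⁻ x, ‖u x‖ₑ ^ (3 : ℝ) := by
  have h32c : (3 / 2 : ℝ≥0∞) = ((3 / 2 : ℝ≥0) : ℝ≥0∞) := by
    rw [ENNReal.coe_div (by norm_num)]; norm_num
  have h1 : (1 : ℝ≥0∞) < 3 / 2 := by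
    rw [h32c]; exact_mod_cast (by norm_num : (1 : ℝ≥0) < 3 / 2)
  have htop : (3 / 2 : ℝ≥0∞) ≠ ⊤ := by rw [h32c]; exact ENNReal.coe_ne_top
  have h0 : (3 / 2 : ℝ≥0∞) ≠ 0 := (zero_lt_one.trans h1).ne'
  obtain ⟨C, hC⟩ := stein1970_normalisedPressure_Lp_bound_holds (3 / 2 : ℝ≥0∞) h1 htop.lt_top
  refine ⟨C, fun u hu huc => ?_⟩
  set A : ℝ≥0∞ := ∫⁻ x, ‖u x‖ₑ ^ (3 : ℝ) with hA
  have hum : AEMeasurable (fun x => ‖u x‖ₑ) volume := hu.continuous.aestronglyMeasurable.enorm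
  have hpm : AEMeasurable (fun x => ‖normalisedPressure u x‖ₑ) volume :=
    (continuous_normalisedPressure_of_hasCompactSupport hu huc).aestronglyMeasurable.enorm
  have h32 : (3 / 2 : ℝ≥0∞).toReal = 3 / 2 := by
    rw [ENNReal.toReal_div, ENNReal.toReal_ofNat, ENNReal.toReal_ofNat]
  -- Hölder with weights `2/3 + 1/3 = 1`
  have hH := ENNReal.lintegral_mul_norm_pow_le (hpm.pow_const (3 / 2 : ℝ)) (hum.pow_const (3 : ℝ))
    (p := 2 / 3) (q := 1 / 3) (by norm_num) (by norm_num) (by norm_num)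
  have hH' : ∫⁻ x, ‖normalisedPressure u x‖ₑ * ‖u x‖ₑ ≤
      (∫⁻ x, ‖normalisedPressure u x‖ₑ ^ (3 / 2 : ℝ)) ^ (2 / 3 : ℝ) * A ^ (1 / 3 : ℝ) := by
    refine le_trans (le_of_eq (lintegral_congr fun x => ?_)) hH
    rw [← ENNReal.rpow_mul, ← ENNReal.rpow_mul]
    norm_num
  -- the `L^{3/2}` norm of the pressure and Stein's bound
  have eP : (∫⁻ x, ‖normalisedPressure u x‖ₑ ^ (3 / 2 : ℝ)) ^ (2 / 3 : ℝ) =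
      eLpNorm (normalisedPressure u) (3 / 2 : ℝ≥0∞) volume := by
    rw [eLpNorm_eq_lintegral_rpow_enorm_toReal h0 htop, h32]
    norm_num
  have eU : eLpNorm (fun x => ‖u x‖ ^ 2) (3 / 2 : ℝ≥0∞) volume = A ^ (2 / 3 : ℝ) := by
    rw [eLpNorm_eq_lintegral_rpow_enorm_toReal h0 htop, h32, hA]
    have : ∀ x, ‖(‖u x‖ ^ 2 : ℝ)‖ₑ ^ (3 / 2 : ℝ) = ‖u x‖ₑ ^ (3 : ℝ) := fun x => by
      rw [enorm_norm_sq, ← ENNReal.rpow_ofNat, ← ENNReal.rpow_mul]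
      norm_num
    simp_rw [this]
    norm_num
  calc ∫⁻ x, ‖normalisedPressure u x‖ₑ * ‖u x‖ₑ
      ≤ eLpNorm (normalisedPressure u) (3 / 2 : ℝ≥0∞) volume * A ^ (1 / 3 : ℝ) := by
        rw [← eP]; exact hH'
    _ ≤ (C * eLpNorm (fun x => ‖u x‖ ^ 2) (3 / 2 : ℝ≥0∞) volume) * A ^ (1 / 3 : ℝ) :=
        mul_le_mul' (hC u hu huc) le_rfl
    _ = C * A := by
        rw [eU, mul_assoc, ← ENNReal.rpow_add_of_nonneg _ _ (by norm_num) (by norm_num)]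
        norm_num

namespace IsNSICantorBlock

variable {T ν₀ τ : ℝ} {M : ℕ} {d : Fin M → (EuclideanSpace ℝ (Fin 3))} {G : Set (EuclideanSpace ℝ (Fin 3))} {w : ℕ → ℝ → (EuclideanSpace ℝ (Fin 3)) → (EuclideanSpace ℝ (Fin 3))}

/-! ### Joint measurability of the pressure of the glued field -/

/-- **Joint continuity of `(s, x) ↦ p̃[w j(s)](x)` on `[t_j, t_{j+1}] × ℝ³`** (accepted
`continuousOn_normalisedPressure_slice`: jointly smooth field with slices supported in the
compact `G`). [folklore] -/
theorem continuousOn_normalisedPressure_piece (h : IsNSICantorBlock T ν₀ τ M d G w) (j : ℕ) :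
    ContinuousOn (fun z : ℝ × (EuclideanSpace ℝ (Fin 3)) => normalisedPressure (w j z.1) z.2)
      (Icc (switchTime T τ j) (switchTime T τ (j + 1)) ×ˢ univ) := by
  obtain ⟨η, hη, hsm⟩ := h.smooth j
  exact continuousOn_normalisedPressure_slice
    (hsm.mono fun s hs => ⟨by linarith [hs.1], by linarith [hs.2]⟩)
    (uniqueDiffOn_Icc (h.switchTime_lt j)) h.isCompact fun s hs x hx => h.piece_apply_eq_zero hs hx

/-- **The pressure of the glued field is jointly measurable on `(0,∞) × ℝ³`** (continuous on each
closed strip, equal to `p̃[0] = 0` from `T₀` on; accepted `aestronglyMeasurable_glue`). [folklore] -/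
theorem aestronglyMeasurable_normalisedPressure_glueSeq (h : IsNSICantorBlock T ν₀ τ M d G w) :
    AEStronglyMeasurable (fun z : ℝ × (EuclideanSpace ℝ (Fin 3)) => normalisedPressure (glueSeq T τ w z.1) z.2)
      ((volume : Measure (ℝ × (EuclideanSpace ℝ (Fin 3)))).restrict (Ioi (0 : ℝ) ×ˢ (univ : Set (EuclideanSpace ℝ (Fin 3))))) := by
  refine aestronglyMeasurable_glue (t := switchTime T τ) (T₀ := blowupTime T τ)
    (switchTime_zero T τ) (tendsto_switchTime h.τ_pos.le h.τ_lt_one)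
    (Wj := fun j z => normalisedPressure (w j z.1) z.2) (h.continuousOn_normalisedPressure_piece)
    (fun j z hz => ?_) (fun z hz => ?_)
  · simp only
    rw [glueSeq_eq_of_mem h.T_pos h.τ_pos w hz.1]
  · simp only
    rw [glueSeq_eq_zero_of_le h.T_pos h.τ_pos h.τ_lt_one w hz, normalisedPressure_zero]
    rfl

/-! ### `|p̃[𝔲]| |𝔲| ∈ L¹((0,∞) × ℝ³)` -/

/-- The slice bound for the glued field: `∫ |p̃[𝔲(t)]| |𝔲(t)| ≤ C ∫ |𝔲(t)|³` for every `t`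
(every slice is `C_c^∞`). [cite: Scheffer1987, Lemma 5.12] -/
theorem exists_lintegral_pressure_mul_enorm_slice_le (h : IsNSICantorBlock T ν₀ τ M d G w) :
    ∃ C : ℝ≥0, ∀ t : ℝ, ∫⁻ x, ‖normalisedPressure (glueSeq T τ w t) x‖ₑ * ‖glueSeq T τ w t x‖ₑ ≤
      C * ∫⁻ x, ‖glueSeq T τ w t x‖ₑ ^ (3 : ℝ) := by
  obtain ⟨C, hC⟩ := exists_lintegral_pressure_mul_enorm_le
  exact ⟨C, fun t => hC _ (h.contDiff_glueSeq t) (h.hasCompactSupport_glueSeq t)⟩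

/-- `∫ dt ∫ |𝔲(t)|³ dx = ∫∫ |𝔲|³ < ∞` (Tonelli and `NavierStokesInequalityCantorCube`).
[cite: Scheffer1987, Lemma 5.12] -/
theorem lintegral_lintegral_enorm_cube_lt_top (h : IsNSICantorBlock T ν₀ τ M d G w) :
    ∫⁻ t : ℝ, ∫⁻ x, ‖glueSeq T τ w t x‖ₑ ^ (3 : ℝ) < ⊤ := by
  have hF : AEMeasurable (fun z : ℝ × (EuclideanSpace ℝ (Fin 3)) => ‖uncurry (glueSeq T τ w) z‖ₑ ^ (3 : ℝ))
      ((volume : Measure ℝ).prod (volume : Measure (EuclideanSpace ℝ (Fin 3)))) := by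
    rw [← Measure.volume_eq_prod]
    exact h.aestronglyMeasurable_glueSeq.aemeasurable.enorm.pow_const _
  have := lintegral_prod _ hF
  rw [← Measure.volume_eq_prod] at this
  simp only [uncurry_apply_pair] at this
  rw [← this]
  exact h.lintegral_enorm_cube_lt_top

/-- The slice integral `t ↦ ∫ |𝔲(t)|³` is a.e.-measurable. [folklore] -/
theorem aemeasurable_lintegral_enorm_cube (h : IsNSICantorBlock T ν₀ τ M d G w) :
    AEMeasurable (fun t : ℝ => ∫⁻ x, ‖glueSeq T τ w t x‖ₑ ^ (3 : ℝ)) (volume : Measure ℝ) := by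
  have hF : AEMeasurable (fun z : ℝ × (EuclideanSpace ℝ (Fin 3)) => ‖uncurry (glueSeq T τ w) z‖ₑ ^ (3 : ℝ))
      ((volume : Measure ℝ).prod (volume : Measure (EuclideanSpace ℝ (Fin 3)))) := by
    rw [← Measure.volume_eq_prod]
    exact h.aestronglyMeasurable_glueSeq.aemeasurable.enorm.pow_const _
  exact hF.lintegral_prod_right'

/-- **`∫∫_{(0,∞)×ℝ³} |p̃[𝔲]| |𝔲| < ∞`** (Scheffer 1987, Lemma 5.12, pressure part; Ożański 2017,
p. 6): Tonelli, the slice bound `∫|p̃||𝔲| ≤ C∫|𝔲|³` and `|𝔲|³ ∈ L¹`.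
[cite: Scheffer1987, Lemma 5.12] [cite: Ozanski2017NSISingular, §2 p. 6] -/
theorem lintegral_pressure_mul_enorm_lt_top (h : IsNSICantorBlock T ν₀ τ M d G w) :
    ∫⁻ z in Ioi (0 : ℝ) ×ˢ (univ : Set (EuclideanSpace ℝ (Fin 3))),
      ‖normalisedPressure (glueSeq T τ w z.1) z.2‖ₑ * ‖glueSeq T τ w z.1 z.2‖ₑ < ⊤ := by
  obtain ⟨C, hC⟩ := h.exists_lintegral_pressure_mul_enorm_slice_le
  set F : ℝ × (EuclideanSpace ℝ (Fin 3)) → ℝ≥0∞ := fun z =>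
    ‖normalisedPressure (glueSeq T τ w z.1) z.2‖ₑ * ‖glueSeq T τ w z.1 z.2‖ₑ with hF
  have hFm : AEMeasurable F ((volume : Measure (ℝ × (EuclideanSpace ℝ (Fin 3)))).restrict (Ioi (0 : ℝ) ×ˢ univ)) :=
    h.aestronglyMeasurable_normalisedPressure_glueSeq.aemeasurable.enorm.mul
      (h.aestronglyMeasurable_glueSeq.aemeasurable.enorm.restrict)
  rw [setLIntegral_prod_univ (Ioi (0 : ℝ)) F hFm]
  calc ∫⁻ t in Ioi (0 : ℝ), ∫⁻ x, F (t, x)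
      ≤ ∫⁻ t in Ioi (0 : ℝ), C * ∫⁻ x, ‖glueSeq T τ w t x‖ₑ ^ (3 : ℝ) :=
        lintegral_mono fun t => hC t
    _ ≤ ∫⁻ t, C * ∫⁻ x, ‖glueSeq T τ w t x‖ₑ ^ (3 : ℝ) := setLIntegral_le_lintegral _ _
    _ = C * ∫⁻ t, ∫⁻ x, ‖glueSeq T τ w t x‖ₑ ^ (3 : ℝ) :=
        lintegral_const_mul'' _ h.aemeasurable_lintegral_enorm_cube
    _ < ⊤ := ENNReal.mul_lt_top ENNReal.coe_lt_top h.lintegral_lintegral_enorm_cube_lt_top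

end IsNSICantorBlock

end Literature.Barriers.NavierStokesRegularity
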